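import Literature.AlgebraicGeometry.HodgeTheory.CyclicReflectionEigenprojectors
import Literature.AlgebraicGeometry.HodgeTheory.CyclicCoverReflectionMonodromy
import HarnessLib

/-!
# Eigencomponents of a vanishing vector: `δ_j := π_j(1 ⊗ δ) ∈ H(ζ^j)` and the complexified cyclic span
# (Carlson–Toledo 1999 §6–§7: "the complex vanishing cycles … are the eigencomponents of ordinary vanishing
# cycles") — packaging, part 3

Family `hodge`, layer `Literature/AlgebraicGeometry/HodgeTheory`. THEOREMS + one definition. Sequel of
`CyclicReflectionComplexification` / `CyclicReflectionEigenprojectors` (R1 of STUB-PLAN-B2-g19, (a) of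
LANE-D-ROADMAP-Ax-g0; crux K1 of `Summits/HodgeConjecture/HodgeConjecture/Theses/CyclicUnitaryPowers.lean`),
linking them with littype's `CyclicCoverReflectionMonodromy` (`cyclicSpan τ δ = span_ℚ {τ^i δ}`): the
eigencomponents `δ_j` of a rational vector, `τ_ℂ δ_j = ζ^j δ_j`, `Σ_j δ_j = 1 ⊗ δ`, `conj δ_j = δ_j(ζ̄)`,
`1 ⊗ τ^i δ = Σ_j ζ^{ij} δ_j`, and every `δ_j` lies in the complexified cyclic span. Written by the prover seat
`hodge-nonav-prover-Ax`. `-- TODO(part 4): h(δ_j, δ_j) ≠ 0 from non-degeneracy of B on the cyclic span;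
the restricted cyclic reflection equals complexReflection (h_j) ε (ζ^j) δ̂_j on H(ζ^j).`

## References
* [CarlsonToledo1999] J. A. Carlson, D. Toledo, Duke Math. J. 97 (1999), §6 Proposition (p. 14), §7 (p. 16).
-/

noncomputable section

open Module Literature.AlgebraicGeometry.Motives
open scoped TensorProduct ComplexConjugate

namespace Literature.AlgebraicGeometry.HodgeTheory

universe v

variable {V : Type v} [AddCommGroup V] [Module ℚ V]

/-- **The `j`-th eigencomponent** `δ_j := π_j (1 ⊗ δ) ∈ H(ζ^j)` of a rational vector `δ` ("complex vanishing
cycle", Carlson–Toledo §7). [cite: CarlsonToledo1999, §7 (p. 16)] -/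
def eigencomponent (τ : V →ₗ[ℚ] V) (p : ℕ) (ζ : ℂ) (j : ℕ) (δ : V) : ℂ ⊗[ℚ] V :=
  cyclicEigenProjector τ p ζ j ((1 : ℂ) ⊗ₜ δ)

/-- [cite: CarlsonToledo1999, §7 (p. 16)] -/
theorem eigencomponent_def (τ : V →ₗ[ℚ] V) (p : ℕ) (ζ : ℂ) (j : ℕ) (δ : V) :
    eigencomponent τ p ζ j δ = cyclicEigenProjector τ p ζ j ((1 : ℂ) ⊗ₜ δ) := rfl

/-- `δ_j ∈ H(ζ^j)`. [cite: CarlsonToledo1999, §7 (p. 16)] -/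
theorem eigencomponent_mem_eigenspace {τ : V →ₗ[ℚ] V} {p : ℕ} (hτ : τ ^ p = 1) {ζ : ℂ} (hζ : ζ ^ p = 1)
    (hζ0 : ζ ≠ 0) (j : ℕ) (δ : V) :
    eigencomponent τ p ζ j δ ∈ Module.End.eigenspace (τ.baseChange ℂ) (ζ ^ j) :=
  cyclicEigenProjector_mem_eigenspace hτ hζ hζ0 j _

/-- `τ_ℂ δ_j = ζ^j δ_j`. [cite: CarlsonToledo1999, §6 Proposition (p. 14)] -/
theorem baseChange_eigencomponent {τ : V →ₗ[ℚ] V} {p : ℕ} (hτ : τ ^ p = 1) {ζ : ℂ} (hζ : ζ ^ p = 1)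
    (hζ0 : ζ ≠ 0) (j : ℕ) (δ : V) :
    τ.baseChange ℂ (eigencomponent τ p ζ j δ) = ζ ^ j • eigencomponent τ p ζ j δ :=
  Module.End.mem_eigenspace_iff.1 (eigencomponent_mem_eigenspace hτ hζ hζ0 j δ)

/-- **`Σ_{j<p} δ_j = 1 ⊗ δ`** (`ζ` primitive). [cite: CarlsonToledo1999, §7 (p. 16)] -/
theorem sum_eigencomponent {τ : V →ₗ[ℚ] V} {p : ℕ} {ζ : ℂ} (hζ : IsPrimitiveRoot ζ p) (hp : 0 < p) (δ : V) :
    ∑ j ∈ Finset.range p, eigencomponent τ p ζ j δ = (1 : ℂ) ⊗ₜ δ :=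
  sum_cyclicEigenProjector hζ hp _

/-- **Conjugate eigencomponents**: `conj δ_j(ζ) = δ_j(ζ̄)` — the eigencomponent of the REAL vector `1 ⊗ δ`
for `ζ̄^j = ζ^{-j}` is the conjugate of its eigencomponent for `ζ^j` (`H(μ̄) = conj H(μ)`).
[cite: CarlsonToledo1999, §2 (p. 5)] -/
theorem conjV_eigencomponent (τ : V →ₗ[ℚ] V) (p : ℕ) (ζ : ℂ) (j : ℕ) (δ : V) :
    conjV V (eigencomponent τ p ζ j δ) = eigencomponent τ p (conj ζ) j δ := by
  rw [eigencomponent, conjV_cyclicEigenProjector, conjV_tmul, map_one]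
  rfl

/-- Powers of `τ_ℂ` on an eigencomponent: `τ_ℂ^i δ_j = ζ^{ij} δ_j`. [cite: CarlsonToledo1999, §6 Proposition (p. 14)] -/
theorem baseChange_pow_eigencomponent {τ : V →ₗ[ℚ] V} {p : ℕ} (hτ : τ ^ p = 1) {ζ : ℂ} (hζ : ζ ^ p = 1)
    (hζ0 : ζ ≠ 0) (i j : ℕ) (δ : V) :
    ((τ.baseChange ℂ) ^ i) (eigencomponent τ p ζ j δ) = ζ ^ (i * j) • eigencomponent τ p ζ j δ := by
  induction i with
  | zero => simp
  | succ i ih =>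
    rw [pow_succ', Module.End.mul_apply, ih, map_smul, baseChange_eigencomponent hτ hζ hζ0, smul_smul,
      Nat.succ_mul, pow_add]

/-- **`1 ⊗ τ^i δ = Σ_j ζ^{ij} δ_j`**: the rational translates of `δ` in terms of its eigencomponents
(`ζ` primitive, `τ^p = 1`). [cite: CarlsonToledo1999, §7 (p. 16)] -/
theorem tmul_pow_apply_eq_sum_eigencomponent {τ : V →ₗ[ℚ] V} {p : ℕ} (hτ : τ ^ p = 1) {ζ : ℂ}
    (hζ : IsPrimitiveRoot ζ p) (hp : 0 < p) (i : ℕ) (δ : V) :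
    (1 : ℂ) ⊗ₜ ((τ ^ i) δ) = ∑ j ∈ Finset.range p, ζ ^ (i * j) • eigencomponent τ p ζ j δ := by
  have hζ0 : ζ ≠ 0 := hζ.ne_zero hp.ne'
  have h1 : (1 : ℂ) ⊗ₜ[ℚ] ((τ ^ i) δ) = ((τ.baseChange ℂ) ^ i) ((1 : ℂ) ⊗ₜ δ) := by
    rw [← LinearMap.baseChange_pow, LinearMap.baseChange_tmul]
  rw [h1, ← sum_eigencomponent (τ := τ) hζ hp δ, map_sum]
  exact Finset.sum_congr rfl fun j _ => baseChange_pow_eigencomponent hτ hζ.pow_eq_one hζ0 i j δ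

/-- **Each eigencomponent lies in the complexified cyclic span** `span_ℂ {1 ⊗ τ^i δ}`
(`= (cyclicSpan τ δ) ⊗ ℂ`): `δ_j = (1/p) Σ_i ζ^{-ij} (1 ⊗ τ^i δ)`. [cite: CarlsonToledo1999, §7 (p. 16)] -/
theorem eigencomponent_mem_span (τ : V →ₗ[ℚ] V) (p : ℕ) (ζ : ℂ) (j : ℕ) (δ : V) :
    eigencomponent τ p ζ j δ ∈ Submodule.span ℂ (Set.range fun i : ℕ => (1 : ℂ) ⊗ₜ[ℚ] ((τ ^ i) δ)) := by
  rw [eigencomponent, cyclicEigenProjector_apply]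
  refine Submodule.smul_mem _ _ (Submodule.sum_mem _ fun i _ => Submodule.smul_mem _ _ ?_)
  rw [← LinearMap.baseChange_pow, LinearMap.baseChange_tmul]
  exact Submodule.subset_span ⟨i, rfl⟩

/-- Conversely the complexified cyclic span is spanned by the eigencomponents: `1 ⊗ τ^i δ ∈ span_ℂ {δ_j}`
(`ζ` primitive). [cite: CarlsonToledo1999, §7 (p. 16)] -/
theorem tmul_pow_apply_mem_span_eigencomponent {τ : V →ₗ[ℚ] V} {p : ℕ} (hτ : τ ^ p = 1) {ζ : ℂ}
    (hζ : IsPrimitiveRoot ζ p) (hp : 0 < p) (i : ℕ) (δ : V) :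
    (1 : ℂ) ⊗ₜ[ℚ] ((τ ^ i) δ) ∈ Submodule.span ℂ (Set.range fun j : ℕ => eigencomponent τ p ζ j δ) := by
  rw [tmul_pow_apply_eq_sum_eigencomponent hτ hζ hp i δ]
  exact Submodule.sum_mem _ fun j _ => Submodule.smul_mem _ _ (Submodule.subset_span ⟨j, rfl⟩)

end Literature.AlgebraicGeometry.HodgeTheory

end
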